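import Literature.MathematicalPhysics.QuantumFieldTheory.Balaban1983to89.T3MinimiserStabilityReduction
import Literature.MathematicalPhysics.QuantumFieldTheory.Balaban1983to89.T3PrintedRegularMinimiser
import Literature.MathematicalPhysics.QuantumFieldTheory.Balaban1983to89.T3PrintedMinimiserExistence
import Literature.MathematicalPhysics.QuantumFieldTheory.Balaban1983to89.T3TiltDescent
import Literature.MathematicalPhysics.QuantumFieldTheory.Balaban1983to89.T3UnitLawDensityEML
import Literature.MathematicalPhysics.QuantumFieldTheory.Balaban1983to89.T3DescentFibreTower
import Literature.MathematicalPhysics.QuantumFieldTheory.Balaban1983to89.T3InteriorExcision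
import Literature.MathematicalPhysics.QuantumFieldTheory.Balaban1983to89.Node00.CanonicalTransportOfRecord
import HarnessLib

/-!
# THE INTERIOR DOOR FOR ROW 2 OF THE S2β TABLE: the loop-ledger letters ⟨SCL⟩, ⟨REP⟩ (full or interior window) GIVE the REGISTERED interior row H4ᶜ∘
# `BeyondOneLoopSmallIntCan` VERBATIM — the «last mile» of R600-ym ∕ ★★OWNER RULING №57 (B) for the REP hand

Cell `ym3-torus` (YM ladder rung R3 = continuum `SU(2)` Yang–Mills on the three-torus — a RUNG, NOT d = 4, NOT infinite volume, NOT a mass gap, NOT Clay).  Seat `ymfull-r3-prover-2`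
(gen 0; R590-ym (a) item (2), re-keyed by R600-ym to the REGISTERED stub `stub_beyondOneLoopSmallIntCan : BeyondOneLoopSmallIntCan`, registry
`Cruxes/FluctuationComparisonRegPrIntL/Lines/semiclassical_s2beta.lean` v11.4 `def` l.571 ∕ stub l.1580); `--supports stmt-QuantumFields-20520 --as helper`, count-neutral, definition-free,
default heartbeats; no registry, binder or `Lines/` edit (RULING №36 untouched).  PLAN of record `Lines/loop_ledger.lean` v6 (ideator ym-r3-idea-1 g19): organ REP `BeyondOneLoopRepCan`
(its hand), SCL `SemiclassicalLimitCan` (✓ in the line from EXW + GAP♯), knit ✓`beyondOneLoopSmallCan_of_rep : SCL → REP → BeyondOneLoopSmallCan`.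

WHAT.  That knit (and px20 g15's product-formula door ✓p783037) ends at the FULL-WINDOW row `BeyondOneLoopSmallCan` (window `PlaqSmall (θBal F.L γ b₀ p₀ J)`); the REGISTERED row since
v11.4 is the INTERIOR row `BeyondOneLoopSmallIntCan`: prefix `∀ L, ∃ c₀, 0 < c₀ ∧ c₀ ≤ 1 ∧ ∀ c, 0 < c → c ≤ c₀ → …`, the four quadrilateral window guards at `θBal F.L γ (c * b₀) p₀ J`,
the history profile inside `fluctAtCan` ∕ `oneLoopFourPtCan` kept at `b₀` (R3-FLIN, ★★OWNER WORD 87 (2)).  THIS FILE TYPES THE RE-DOCKING, def-free, every text δ-unfolded as in ✓p783037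
(`heightDensityCan` ↦ `Node00.canonVersion (fieldMeasure …) (heightDensity …)`, `fluctAtCan`, `oneLoopPartCan` ∕ `oneLoopFourPtCan` ↦ `limUnder atTop …`, `fourPt`, `PolymerRepOn` ∕ `IsLocal`):
* §1 (generic: any lattice, group, window set): `fourPt_le_of_polymerSum` — a V-local polymer sum of weighted norm `≤ N` at rate `κ ≥ 0` has connected 4-points `≤ 4N·e^{−κ·tdist(b,b′)}`
  under the four one-bond moves (registry §1b ✓`fourPoint_le_of_polymerNorm`, LINE g17-1's proof lifted — credit ym-r3-idea-1); ★ `fourPt_sub_limUnder_le` — ONE DEPTH: if on `W`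
  `f 1 = c + limUnder_λ (f λ · − f λ 𝟙) + R` with `R` polymer-represented of norm `≤ a` and the four corner limits exist, then `|Δ²(f 1) − limUnder_λ Δ²(f λ)| ≤ 4a·e^{−κ·tdist}`.
* §2 (SU(2), T3Family; prefixes threaded): ★★ `beyondOneLoopSmallInt_of_repInt : ⟨SCL∘⟩ → ⟨REP∘⟩ → ⟨BeyondOneLoopSmallIntCan VERBATIM⟩` (φ₂ J := 4 Φ J), ⟨SCL∘⟩ ∕ ⟨REP∘⟩ = the
  loop-ledger texts with the registry's TWO ∘-MOVES (fraction prefix after `∀ L`; window clauses at `cw * b₀`; history `b₀`); ★ `sclInt_of_scl : ⟨SCL⟩ → ⟨SCL∘⟩`, ★ `repInt_of_rep :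
  ⟨REP⟩ → ⟨REP∘⟩` (`c₀ := 1`, `γ₁ ↦ min γ₁ 1`: interior ⊆ full window by lit ✓`T3InteriorExcision.θBal_mul_le` + ✓`T3PrintedMinimiserExistence.plaqSmall_of_le`; identity ∕ domination
  clauses restrict); ★★ `beyondOneLoopSmallInt_of_rep : ⟨SCL⟩ → ⟨REP⟩ → ⟨BeyondOneLoopSmallIntCan VERBATIM⟩` — the plan's OWN full-window letters deliver the REGISTERED stub, zero new organ.
Door-fit (HOME cert `ymfull-r3-prover-2/g0/DOORFIT-BeyondOneLoopInteriorDoor.cert.lean`, registry v11.4 + loop_ledger v6 texts pasted):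
`example : SemiclassicalLimitCan → BeyondOneLoopRepCan → BeyondOneLoopSmallIntCan := fun hS hR => beyondOneLoopSmallInt_of_rep hS hR`.

HONEST SCOPE.  Filter ∕ finite-sum algebra and quantifier plumbing; ⟨SCL⟩, ⟨REP⟩ and their ∘-twins are HYPOTHESES (REP = the XL small-field cluster expansion of [Balaban1987RG1] Thm 1 ∕
[Balaban1988Convergent] read in d = 3 in identity form — nobody's theorem; SCL is proved in the Lines file from EXW ∕ GAP♯, not here); nothing of Bałaban's is asserted or proved;
`BeyondOneLoopSmallIntCan`, the other four registered ∘-stubs, S2β and `FluctuationComparisonRegPrIntL` (stmt-QuantumFields-20520) are NOT proved; no summit statement is proved by a helper;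
rung R3 = SU(2) YM₃ on T³ — finite volume, conditional; NOT d = 4, NOT infinite volume, NOT a mass gap, NOT Clay; the Yang–Mills mass gap is NOT proved.

References: T. Bałaban, CMP **102** (1985) 255–275 [Balaban1985UV3] ((7) p.257, (41)–(47) pp.266–267); CMP **109** (1987) 249–301 [Balaban1987RG1] (Thm 1, (0.22)–(0.26) pp.256–257);
CMP **119** (1988) 243–285 [Balaban1988Convergent] (Thm 1); CMP **102** (1985) 277–309 [Balaban1985Variational] (Thm 1 (8) p.279).
-/

noncomputable section

open MeasureTheory Filter Topology Set
open Literature.MathematicalPhysics.QuantumFieldTheory.Balaban1983to89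
open Literature.MathematicalPhysics.QuantumFieldTheory.Balaban1983to89.T3ContinuumYM3Torus
open Literature.MathematicalPhysics.QuantumFieldTheory.Balaban1983to89.T3NestedUnitLaws
open Literature.MathematicalPhysics.QuantumFieldTheory.Balaban1983to89.T3UnitLawDensityEML
open Literature.MathematicalPhysics.QuantumFieldTheory.Balaban1983to89.T3UnitScaleTilt
open Literature.MathematicalPhysics.QuantumFieldTheory.Balaban1983to89.T3TiltDescent
open Literature.MathematicalPhysics.QuantumFieldTheory.Balaban1983to89.T3PrintedRegularMinimiser

namespace Summit.QuantumFields.YangMills.Theorems.BeyondOneLoopInteriorDoor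

/-! ## §1 Generic: the 4-point of a V-local polymer sum; one depth of the re-docking -/

section Generic

variable {P : Params} {G : Type*}
open Classical in
/-- **PC · POLYMER NORM ⇒ κ-CLUSTERED CONNECTED 4-POINTS** (registry §1b `fourPoint_le_of_polymerNorm`, LINE g17-1; proof lifted verbatim): under the four one-bond window
moves at bonds `b, b′`, polymers whose support misses `b` or misses `b′` cancel EXACTLY by V-locality; each survivor contributes `≤ 4·wt X ≤ 4·wt X·e^{κ len X}·e^{−κ·tdist(b,b′)}`
(`len X ≥ tdist`), and the weighted norm sums them. [cite: Balaban1987RG1, (0.23)-(0.26) pp.256-257] -/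
theorem fourPt_le_of_polymerSum {n : ℕ} (W : Set (GaugeField P 0 G)) (supp : Fin n → Finset (PBond P 0)) (len wt : Fin n → ℝ)
    (act : Fin n → GaugeField P 0 G → ℝ) (κ N c : ℝ) (hκ : 0 ≤ κ)
    (hloc : ∀ X (U U' : GaugeField P 0 G), (∀ e ∈ supp X, U e = U' e) → act X U = act X U')
    (hwt : ∀ X, 0 ≤ wt X)
    (hdiam : ∀ X, ∀ e ∈ supp X, ∀ e' ∈ supp X, (e.src.tdist e'.src : ℝ) ≤ len X)
    (hbd : ∀ X U, U ∈ W → |act X U| ≤ wt X)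
    (hcov : ∀ e : PBond P 0, ∑ X ∈ Finset.univ.filter (fun X => e ∈ supp X), wt X * Real.exp (κ * len X) ≤ N)
    (b b' : PBond P 0) (U V Y Z : GaugeField P 0 G) (hU : U ∈ W) (hV : V ∈ W) (hY : Y ∈ W) (hZ : Z ∈ W)
    (hUV : ∀ e, e ≠ b → U e = V e) (hUY : ∀ e, e ≠ b' → U e = Y e) (hVZ : ∀ e, e ≠ b' → V e = Z e)
    (hYZ : ∀ e, e ≠ b → Y e = Z e) :
    |((c + ∑ X, act X U) - (c + ∑ X, act X V)) - ((c + ∑ X, act X Y) - (c + ∑ X, act X Z))|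
      ≤ 4 * N * Real.exp (-(κ * (b.src.tdist b'.src : ℝ))) := by
  set d : ℝ := (b.src.tdist b'.src : ℝ) with hd
  have hT : ((c + ∑ X, act X U) - (c + ∑ X, act X V)) - ((c + ∑ X, act X Y) - (c + ∑ X, act X Z))
      = ∑ X, ((act X U - act X V) - (act X Y - act X Z)) := by
    simp only [Finset.sum_sub_distrib]; ring
  rw [hT]
  have hpt : ∀ X, |(act X U - act X V) - (act X Y - act X Z)|
      ≤ if b ∈ supp X then 4 * (wt X * Real.exp (κ * len X)) * Real.exp (-(κ * d)) else 0 := by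
    intro X
    by_cases hb : b ∈ supp X
    · rw [if_pos hb]
      by_cases hb' : b' ∈ supp X
      · have hdle : d ≤ len X := hdiam X b hb b' hb'
        have hkey : wt X ≤ wt X * Real.exp (κ * len X) * Real.exp (-(κ * d)) := by
          rw [mul_assoc, ← Real.exp_add]
          have h0 : 0 ≤ κ * len X + -(κ * d) := by nlinarith
          calc wt X = wt X * 1 := (mul_one _).symm
            _ ≤ wt X * Real.exp (κ * len X + -(κ * d)) := mul_le_mul_of_nonneg_left (Real.one_le_exp h0) (hwt X)
        have h1 := abs_le.mp (hbd X U hU)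
        have h2 := abs_le.mp (hbd X V hV)
        have h3 := abs_le.mp (hbd X Y hY)
        have h4 := abs_le.mp (hbd X Z hZ)
        have h5 : |(act X U - act X V) - (act X Y - act X Z)| ≤ 4 * wt X :=
          abs_le.mpr ⟨by linarith [h1.1, h2.2, h3.2, h4.1], by linarith [h1.2, h2.1, h3.1, h4.2]⟩
        calc |(act X U - act X V) - (act X Y - act X Z)| ≤ 4 * wt X := h5
          _ ≤ 4 * (wt X * Real.exp (κ * len X) * Real.exp (-(κ * d))) := by linarith
          _ = 4 * (wt X * Real.exp (κ * len X)) * Real.exp (-(κ * d)) := by ring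
      · have e1 : act X U = act X Y := hloc X U Y (fun e he => hUY e (fun h => hb' (h ▸ he)))
        have e2 : act X V = act X Z := hloc X V Z (fun e he => hVZ e (fun h => hb' (h ▸ he)))
        have hw := hwt X
        rw [e1, e2]
        simp only [sub_self, abs_zero]
        positivity
    · rw [if_neg hb]
      have e1 : act X U = act X V := hloc X U V (fun e he => hUV e (fun h => hb (h ▸ he)))
      have e2 : act X Y = act X Z := hloc X Y Z (fun e he => hYZ e (fun h => hb (h ▸ he)))
      rw [e1, e2]
      simp only [sub_self, abs_zero, le_refl]
  calc |∑ X, ((act X U - act X V) - (act X Y - act X Z))|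
      ≤ ∑ X, |(act X U - act X V) - (act X Y - act X Z)| := Finset.abs_sum_le_sum_abs _ _
    _ ≤ ∑ X, (if b ∈ supp X then 4 * (wt X * Real.exp (κ * len X)) * Real.exp (-(κ * d)) else 0) :=
        Finset.sum_le_sum (fun X _ => hpt X)
    _ = (∑ X ∈ Finset.univ.filter (fun X => b ∈ supp X), wt X * Real.exp (κ * len X)) * (4 * Real.exp (-(κ * d))) := by
        rw [Finset.sum_filter, Finset.sum_mul]
        refine Finset.sum_congr rfl (fun X _ => ?_)
        split_ifs <;> ring
    _ ≤ N * (4 * Real.exp (-(κ * d))) := by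
        have h4 : 0 ≤ 4 * Real.exp (-(κ * d)) := by positivity
        exact mul_le_mul_of_nonneg_right (hcov b) h4
    _ = 4 * N * Real.exp (-(κ * d)) := by ring

open Classical in
/-- ★ **ONE DEPTH OF THE RE-DOCKING.**  A λ-family `f : ℝ → field → ℝ` on a window `W` with a normalising datum `𝟙`: if on `W` the physical member splits as
`f 1 U = c + limUnder_{λ→∞} (f λ U − f λ 𝟙) + R U` with `R = c′ + Σ_X act X` a V-local polymer sum of weighted norm `≤ a` at rate `κ ≥ 0`, and at the four corners of a window
quadrilateral the limits `lim_λ (f λ · − f λ 𝟙)` EXIST, then `limUnder_λ Δ²(f λ) = Δ²(lim)` and `|Δ²(f 1) − limUnder_λ Δ²(f λ)| = |Δ² R| ≤ 4a·e^{−κ·tdist(b,b′)}` (LINE g19-2's depth step, window-agnostic).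
[cite: Balaban1985UV3, (45)-(47) p.267; Balaban1985Variational, Thm 1 (8) p.279] -/
theorem fourPt_sub_limUnder_le (W : Set (GaugeField P 0 G)) (f : ℝ → GaugeField P 0 G → ℝ) (one : GaugeField P 0 G)
    {κ a c : ℝ} (hκ : 0 ≤ κ) (R : GaugeField P 0 G → ℝ)
    (hid : ∀ U : GaugeField P 0 G, U ∈ W → f 1 U = c + limUnder atTop (fun lam : ℝ => f lam U - f lam one) + R U)
    (hrep : ∃ (n : ℕ) (supp : Fin n → Finset (PBond P 0)) (len wt : Fin n → ℝ) (act : Fin n → GaugeField P 0 G → ℝ) (c' : ℝ),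
      (∀ X (U U' : GaugeField P 0 G), (∀ e ∈ supp X, U e = U' e) → act X U = act X U') ∧ (∀ X, 0 ≤ wt X) ∧
      (∀ X, ∀ e ∈ supp X, ∀ e' ∈ supp X, (e.src.tdist e'.src : ℝ) ≤ len X) ∧
      (∀ X U, U ∈ W → |act X U| ≤ wt X) ∧
      (∀ e : PBond P 0, ∑ X ∈ Finset.univ.filter (fun X => e ∈ supp X), wt X * Real.exp (κ * len X) ≤ a) ∧
      ∀ U, U ∈ W → R U = c' + ∑ X, act X U)
    (b b' : PBond P 0) (U V Y Z : GaugeField P 0 G) (hU : U ∈ W) (hV : V ∈ W) (hY : Y ∈ W) (hZ : Z ∈ W)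
    (hlU : ∃ l : ℝ, Tendsto (fun lam : ℝ => f lam U - f lam one) atTop (𝓝 l))
    (hlV : ∃ l : ℝ, Tendsto (fun lam : ℝ => f lam V - f lam one) atTop (𝓝 l))
    (hlY : ∃ l : ℝ, Tendsto (fun lam : ℝ => f lam Y - f lam one) atTop (𝓝 l))
    (hlZ : ∃ l : ℝ, Tendsto (fun lam : ℝ => f lam Z - f lam one) atTop (𝓝 l))
    (hUV : ∀ e, e ≠ b → U e = V e) (hUY : ∀ e, e ≠ b' → U e = Y e) (hVZ : ∀ e, e ≠ b' → V e = Z e)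
    (hYZ : ∀ e, e ≠ b → Y e = Z e) :
    |((f 1 U - f 1 V) - (f 1 Y - f 1 Z)) - limUnder atTop (fun lam : ℝ => (f lam U - f lam V) - (f lam Y - f lam Z))|
      ≤ 4 * a * Real.exp (-(κ * (b.src.tdist b'.src : ℝ))) := by
  -- the four normalised limits and the limit of the 4-point
  set F₀ : GaugeField P 0 G → ℝ := fun X => limUnder atTop (fun lam : ℝ => f lam X - f lam one) with hF₀
  have t4 : Tendsto (fun lam : ℝ => (f lam U - f lam V) - (f lam Y - f lam Z)) atTop (𝓝 ((F₀ U - F₀ V) - (F₀ Y - F₀ Z))) :=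
    (((tendsto_nhds_limUnder hlU).sub (tendsto_nhds_limUnder hlV)).sub
      ((tendsto_nhds_limUnder hlY).sub (tendsto_nhds_limUnder hlZ))).congr (fun lam => by ring)
  rw [t4.limUnder_eq]
  -- the physical member minus the one-loop 4-point is the 4-point of `R`
  obtain ⟨n, supp, len, wt, act, c', hloc, hwt, hdiam, hbd, hcov, hR⟩ := hrep
  have hsplit : ((f 1 U - f 1 V) - (f 1 Y - f 1 Z)) - ((F₀ U - F₀ V) - (F₀ Y - F₀ Z))
      = ((c' + ∑ X, act X U) - (c' + ∑ X, act X V)) - ((c' + ∑ X, act X Y) - (c' + ∑ X, act X Z)) := by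
    rw [hid U hU, hid V hV, hid Y hY, hid Z hZ, hR U hU, hR V hV, hR Y hY, hR Z hZ]
    simp only [hF₀]
    ring
  rw [hsplit]
  exact fourPt_le_of_polymerSum W supp len wt act κ a c' hκ hloc hwt hdiam hbd hcov b b' U V Y Z hU hV hY hZ hUV hUY hVZ hYZ

end Generic

/-! ## §2 The doors with the quantifier prefixes threaded: ⟨SCL∘⟩ → ⟨REP∘⟩ → H4ᶜ∘; full window ⟹ interior window for SCL and REP; ⟨SCL⟩ → ⟨REP⟩ → H4ᶜ∘ -/

section Doors

open Classical in
/-- ★★ **⟨SCL∘⟩ → ⟨REP∘⟩ → H4ᶜ∘ `BeyondOneLoopSmallIntCan` VERBATIM (δ-unfolded).**  ⟨SCL∘⟩ ∕ ⟨REP∘⟩ = LINE g19-2's `SemiclassicalLimitCan` ∕ `BeyondOneLoopRepCan` with the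
registry's two ∘-moves (fraction prefix `∃ c₀, 0 < c₀ ∧ c₀ ≤ 1 ∧ ∀ cw, 0 < cw → cw ≤ c₀ →` after `∀ L`; every WINDOW clause at `θBal F.L γ (cw * b₀) p₀ J`; the history
`histGood F ℰp (θBal F.L γ b₀ p₀) K J` unchanged).  Proof: common fraction `min c₀ᵢ`, thresholds by `max` ∕ `min`, `φ₂ J := 4 Φ J`, and §1 ★ at every depth.
[cite: Balaban1985UV3, (45)-(47) p.267; Balaban1987RG1, (0.22)-(0.26) pp.256-257] -/
theorem beyondOneLoopSmallInt_of_repInt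
    (hS : ∀ (L : ℕ), ∃ c₀ : ℝ, 0 < c₀ ∧ c₀ ≤ 1 ∧ ∀ (cw : ℝ), 0 < cw → cw ≤ c₀ →
      ∃ pS : ℝ, ∀ (b₀ p₀ : ℝ), 0 < b₀ → pS ≤ p₀ → 0 < p₀ → ∃ ε₁ : ℝ, 0 < ε₁ ∧ ∀ (ε₀ : ℝ), 0 < ε₀ → ε₀ ≤ ε₁ →
      ∃ γ₁ : ℝ, 0 < γ₁ ∧ ∀ (F : T3Family) (γ : ℝ), F.L = L → 0 < γ → γ ≤ γ₁ →
        ∀ (J K : ℕ) (hJK : J ≤ K) (V : GaugeField (F.P J) 0 (Matrix.specialUnitaryGroup (Fin 2) ℂ)), PlaqSmall (θBal F.L γ (cw * b₀) p₀ J) V →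
          ∃ a : ℝ, Tendsto (fun lam : ℝ =>
            (Real.log (Node00.canonVersion (fieldMeasure (F.P J) 0 (Matrix.specialUnitaryGroup (Fin 2) ℂ)) (heightDensity F (γ / lam) hJK (histGood F ℰp (θBal F.L γ b₀ p₀) K J)) V) + (F.scheme ℰp (γ / lam)).β K * minActionRegPr F J K hJK ε₀ V)
            - (Real.log (Node00.canonVersion (fieldMeasure (F.P J) 0 (Matrix.specialUnitaryGroup (Fin 2) ℂ)) (heightDensity F (γ / lam) hJK (histGood F ℰp (θBal F.L γ b₀ p₀) K J)) 1) + (F.scheme ℰp (γ / lam)).β K * minActionRegPr F J K hJK ε₀ 1)) atTop (𝓝 a))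
    (hR : ∀ (L : ℕ), ∃ c₀ : ℝ, 0 < c₀ ∧ c₀ ≤ 1 ∧ ∀ (cw : ℝ), 0 < cw → cw ≤ c₀ →
      ∃ pS : ℝ, ∀ (b₀ p₀ : ℝ), 0 < b₀ → pS ≤ p₀ → 0 < p₀ → ∃ ε₁ : ℝ, 0 < ε₁ ∧ ∀ (ε₀ : ℝ), 0 < ε₀ → ε₀ ≤ ε₁ →
      ∃ γ₁ : ℝ, 0 < γ₁ ∧ ∃ κ : ℝ, 0 < κ ∧
        ∀ (F : T3Family) (γ : ℝ), F.L = L → 0 < γ → γ ≤ γ₁ →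
          ∃ Φ : ℕ → ℝ, (∀ J, 0 ≤ Φ J) ∧ Tendsto (fun J : ℕ => (J : ℝ) * Φ J) atTop (𝓝 0) ∧
            ∀ (J K : ℕ) (hJK : J ≤ K),
              ∃ (c : ℝ) (R : GaugeField (F.P J) 0 (Matrix.specialUnitaryGroup (Fin 2) ℂ) → ℝ) (a : ℝ),
                (∀ U : GaugeField (F.P J) 0 (Matrix.specialUnitaryGroup (Fin 2) ℂ), PlaqSmall (θBal F.L γ (cw * b₀) p₀ J) U →
                  (Real.log (Node00.canonVersion (fieldMeasure (F.P J) 0 (Matrix.specialUnitaryGroup (Fin 2) ℂ)) (heightDensity F (γ / 1) hJK (histGood F ℰp (θBal F.L γ b₀ p₀) K J)) U) + (F.scheme ℰp (γ / 1)).β K * minActionRegPr F J K hJK ε₀ U)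
                      = c + limUnder atTop (fun lam : ℝ => (Real.log (Node00.canonVersion (fieldMeasure (F.P J) 0 (Matrix.specialUnitaryGroup (Fin 2) ℂ)) (heightDensity F (γ / lam) hJK (histGood F ℰp (θBal F.L γ b₀ p₀) K J)) U) + (F.scheme ℰp (γ / lam)).β K * minActionRegPr F J K hJK ε₀ U)
                          - (Real.log (Node00.canonVersion (fieldMeasure (F.P J) 0 (Matrix.specialUnitaryGroup (Fin 2) ℂ)) (heightDensity F (γ / lam) hJK (histGood F ℰp (θBal F.L γ b₀ p₀) K J)) 1) + (F.scheme ℰp (γ / lam)).β K * minActionRegPr F J K hJK ε₀ 1)) + R U) ∧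
                (∃ (n : ℕ) (supp : Fin n → Finset (PBond (F.P J) 0)) (len wt : Fin n → ℝ) (act : Fin n → GaugeField (F.P J) 0 (Matrix.specialUnitaryGroup (Fin 2) ℂ) → ℝ) (c' : ℝ),
                  (∀ X (U U' : GaugeField (F.P J) 0 (Matrix.specialUnitaryGroup (Fin 2) ℂ)), (∀ e ∈ supp X, U e = U' e) → act X U = act X U') ∧
                  (∀ X, 0 ≤ wt X) ∧
                  (∀ X, ∀ e ∈ supp X, ∀ e' ∈ supp X, (e.src.tdist e'.src : ℝ) ≤ len X) ∧
                  (∀ X U, U ∈ {U : GaugeField (F.P J) 0 (Matrix.specialUnitaryGroup (Fin 2) ℂ) | PlaqSmall (θBal F.L γ (cw * b₀) p₀ J) U} → |act X U| ≤ wt X) ∧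
                  (∀ e : PBond (F.P J) 0, ∑ X ∈ Finset.univ.filter (fun X => e ∈ supp X), wt X * Real.exp (κ * len X) ≤ a) ∧
                  ∀ U, U ∈ {U : GaugeField (F.P J) 0 (Matrix.specialUnitaryGroup (Fin 2) ℂ) | PlaqSmall (θBal F.L γ (cw * b₀) p₀ J) U} →
                    R U = c' + ∑ X, act X U) ∧
                a ≤ Φ J) :
    ∀ (L : ℕ), ∃ c₀ : ℝ, 0 < c₀ ∧ c₀ ≤ 1 ∧ ∀ (c : ℝ), 0 < c → c ≤ c₀ → ∃ pS : ℝ, ∀ (b₀ p₀ : ℝ), 0 < b₀ → pS ≤ p₀ → 0 < p₀ →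
      ∃ ε₁ : ℝ, 0 < ε₁ ∧ ∀ (ε₀ : ℝ), 0 < ε₀ → ε₀ ≤ ε₁ →
      ∃ γ₁ : ℝ, 0 < γ₁ ∧ ∃ κ : ℝ, 0 < κ ∧ ∀ (F : T3Family) (γ : ℝ), F.L = L → 0 < γ → γ ≤ γ₁ →
        ∃ φ₂ : ℕ → ℝ, (∀ J, 0 ≤ φ₂ J) ∧ Tendsto (fun J : ℕ => (J : ℝ) * φ₂ J) atTop (𝓝 0) ∧
          ∀ (J K : ℕ) (hJK : J ≤ K) (b b' : PBond (F.P J) 0) (U V W Z : GaugeField (F.P J) 0 (Matrix.specialUnitaryGroup (Fin 2) ℂ)),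
            PlaqSmall (θBal F.L γ (c * b₀) p₀ J) U → PlaqSmall (θBal F.L γ (c * b₀) p₀ J) V →
            PlaqSmall (θBal F.L γ (c * b₀) p₀ J) W → PlaqSmall (θBal F.L γ (c * b₀) p₀ J) Z →
            (∀ e, e ≠ b → U e = V e) → (∀ e, e ≠ b' → U e = W e) → (∀ e, e ≠ b' → V e = Z e) → (∀ e, e ≠ b → W e = Z e) →
            |(((Real.log (Node00.canonVersion (fieldMeasure (F.P J) 0 (Matrix.specialUnitaryGroup (Fin 2) ℂ)) (heightDensity F (γ / 1) hJK (histGood F ℰp (θBal F.L γ b₀ p₀) K J)) U) + (F.scheme ℰp (γ / 1)).β K * minActionRegPr F J K hJK ε₀ U)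
                - (Real.log (Node00.canonVersion (fieldMeasure (F.P J) 0 (Matrix.specialUnitaryGroup (Fin 2) ℂ)) (heightDensity F (γ / 1) hJK (histGood F ℰp (θBal F.L γ b₀ p₀) K J)) V) + (F.scheme ℰp (γ / 1)).β K * minActionRegPr F J K hJK ε₀ V))
              - ((Real.log (Node00.canonVersion (fieldMeasure (F.P J) 0 (Matrix.specialUnitaryGroup (Fin 2) ℂ)) (heightDensity F (γ / 1) hJK (histGood F ℰp (θBal F.L γ b₀ p₀) K J)) W) + (F.scheme ℰp (γ / 1)).β K * minActionRegPr F J K hJK ε₀ W)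
                - (Real.log (Node00.canonVersion (fieldMeasure (F.P J) 0 (Matrix.specialUnitaryGroup (Fin 2) ℂ)) (heightDensity F (γ / 1) hJK (histGood F ℰp (θBal F.L γ b₀ p₀) K J)) Z) + (F.scheme ℰp (γ / 1)).β K * minActionRegPr F J K hJK ε₀ Z)))
              - limUnder atTop (fun lam : ℝ =>
                ((Real.log (Node00.canonVersion (fieldMeasure (F.P J) 0 (Matrix.specialUnitaryGroup (Fin 2) ℂ)) (heightDensity F (γ / lam) hJK (histGood F ℰp (θBal F.L γ b₀ p₀) K J)) U) + (F.scheme ℰp (γ / lam)).β K * minActionRegPr F J K hJK ε₀ U)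
                  - (Real.log (Node00.canonVersion (fieldMeasure (F.P J) 0 (Matrix.specialUnitaryGroup (Fin 2) ℂ)) (heightDensity F (γ / lam) hJK (histGood F ℰp (θBal F.L γ b₀ p₀) K J)) V) + (F.scheme ℰp (γ / lam)).β K * minActionRegPr F J K hJK ε₀ V))
                - ((Real.log (Node00.canonVersion (fieldMeasure (F.P J) 0 (Matrix.specialUnitaryGroup (Fin 2) ℂ)) (heightDensity F (γ / lam) hJK (histGood F ℰp (θBal F.L γ b₀ p₀) K J)) W) + (F.scheme ℰp (γ / lam)).β K * minActionRegPr F J K hJK ε₀ W)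
                  - (Real.log (Node00.canonVersion (fieldMeasure (F.P J) 0 (Matrix.specialUnitaryGroup (Fin 2) ℂ)) (heightDensity F (γ / lam) hJK (histGood F ℰp (θBal F.L γ b₀ p₀) K J)) Z) + (F.scheme ℰp (γ / lam)).β K * minActionRegPr F J K hJK ε₀ Z)))|
              ≤ φ₂ J * Real.exp (-(κ * (b.src.tdist b'.src : ℝ))) := by
  intro L
  obtain ⟨c₁, hc₁, hc₁1, HS⟩ := hS L
  obtain ⟨c₂, hc₂, -, HR⟩ := hR L
  refine ⟨min c₁ c₂, lt_min hc₁ hc₂, (min_le_left _ _).trans hc₁1, fun c hc hcle => ?_⟩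
  obtain ⟨pS₁, HS1⟩ := HS c hc (hcle.trans (min_le_left _ _))
  obtain ⟨pS₂, HR1⟩ := HR c hc (hcle.trans (min_le_right _ _))
  refine ⟨max pS₁ pS₂, fun b₀ p₀ hb₀ hp hp₀ => ?_⟩
  obtain ⟨ε₁, hε₁, HS2⟩ := HS1 b₀ p₀ hb₀ ((le_max_left _ _).trans hp) hp₀
  obtain ⟨ε₂, hε₂, HR2⟩ := HR1 b₀ p₀ hb₀ ((le_max_right _ _).trans hp) hp₀
  refine ⟨min ε₁ ε₂, lt_min hε₁ hε₂, fun ε₀ hε₀ hε₀le => ?_⟩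
  obtain ⟨γ₁, hγ₁, HS3⟩ := HS2 ε₀ hε₀ (hε₀le.trans (min_le_left _ _))
  obtain ⟨γ₂, hγ₂, κ, hκ, HR3⟩ := HR2 ε₀ hε₀ (hε₀le.trans (min_le_right _ _))
  refine ⟨min γ₁ γ₂, lt_min hγ₁ hγ₂, κ, hκ, fun F γ hFL hγ hγle => ?_⟩
  have HS4 := HS3 F γ hFL hγ (hγle.trans (min_le_left _ _))
  obtain ⟨Φ, hΦ0, hΦlim, HR4⟩ := HR3 F γ hFL hγ (hγle.trans (min_le_right _ _))
  refine ⟨fun J => 4 * Φ J, fun J => mul_nonneg (by norm_num) (hΦ0 J), ?_, ?_⟩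
  · have h4 : Tendsto (fun J : ℕ => 4 * ((J : ℝ) * Φ J)) atTop (𝓝 (4 * 0)) := hΦlim.const_mul _
    rw [mul_zero] at h4
    exact h4.congr' (Eventually.of_forall fun J => by ring)
  · intro J K hJK b b' U V W Z hU hV hW hZ hUV hUW hVZ hWZ
    obtain ⟨c', R, a, hid, hrep, ha⟩ := HR4 J K hJK
    have key := fourPt_sub_limUnder_le {X : GaugeField (F.P J) 0 (Matrix.specialUnitaryGroup (Fin 2) ℂ) | PlaqSmall (θBal F.L γ (c * b₀) p₀ J) X}
      (fun (lam : ℝ) (X : GaugeField (F.P J) 0 (Matrix.specialUnitaryGroup (Fin 2) ℂ)) =>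
        Real.log (Node00.canonVersion (fieldMeasure (F.P J) 0 (Matrix.specialUnitaryGroup (Fin 2) ℂ)) (heightDensity F (γ / lam) hJK (histGood F ℰp (θBal F.L γ b₀ p₀) K J)) X) + (F.scheme ℰp (γ / lam)).β K * minActionRegPr F J K hJK ε₀ X)
      1 hκ.le R hid hrep b b' U V W Z hU hV hW hZ (HS4 J K hJK U hU) (HS4 J K hJK V hV) (HS4 J K hJK W hW) (HS4 J K hJK Z hZ)
      hUV hUW hVZ hWZ
    calc _ ≤ 4 * a * Real.exp (-(κ * (b.src.tdist b'.src : ℝ))) := key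
      _ ≤ 4 * Φ J * Real.exp (-(κ * (b.src.tdist b'.src : ℝ))) := by gcongr

/-- ★ **FULL WINDOW ⟹ INTERIOR WINDOW FOR SCL**: `SemiclassicalLimitCan` of LINE g19-2 (δ-unfolded) gives ⟨SCL∘⟩ with `c₀ := 1`, `γ₁ ↦ min γ₁ 1` — an interior datum is a
window datum (`θBal F.L γ (cw * b₀) p₀ J ≤ θBal F.L γ b₀ p₀ J` for `cw ≤ 1`, `γ ≤ 1`). [cite: Balaban1985UV3, (7) p.257; Balaban1985Variational, Thm 1 (8) p.279] -/
theorem sclInt_of_scl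
    (hS : ∀ (L : ℕ), ∃ pS : ℝ, ∀ (b₀ p₀ : ℝ), 0 < b₀ → pS ≤ p₀ → 0 < p₀ → ∃ ε₁ : ℝ, 0 < ε₁ ∧ ∀ (ε₀ : ℝ), 0 < ε₀ → ε₀ ≤ ε₁ →
      ∃ γ₁ : ℝ, 0 < γ₁ ∧ ∀ (F : T3Family) (γ : ℝ), F.L = L → 0 < γ → γ ≤ γ₁ →
        ∀ (J K : ℕ) (hJK : J ≤ K) (V : GaugeField (F.P J) 0 (Matrix.specialUnitaryGroup (Fin 2) ℂ)), PlaqSmall (θBal F.L γ b₀ p₀ J) V →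
          ∃ a : ℝ, Tendsto (fun lam : ℝ =>
            (Real.log (Node00.canonVersion (fieldMeasure (F.P J) 0 (Matrix.specialUnitaryGroup (Fin 2) ℂ)) (heightDensity F (γ / lam) hJK (histGood F ℰp (θBal F.L γ b₀ p₀) K J)) V) + (F.scheme ℰp (γ / lam)).β K * minActionRegPr F J K hJK ε₀ V)
            - (Real.log (Node00.canonVersion (fieldMeasure (F.P J) 0 (Matrix.specialUnitaryGroup (Fin 2) ℂ)) (heightDensity F (γ / lam) hJK (histGood F ℰp (θBal F.L γ b₀ p₀) K J)) 1) + (F.scheme ℰp (γ / lam)).β K * minActionRegPr F J K hJK ε₀ 1)) atTop (𝓝 a)) :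
    ∀ (L : ℕ), ∃ c₀ : ℝ, 0 < c₀ ∧ c₀ ≤ 1 ∧ ∀ (cw : ℝ), 0 < cw → cw ≤ c₀ →
      ∃ pS : ℝ, ∀ (b₀ p₀ : ℝ), 0 < b₀ → pS ≤ p₀ → 0 < p₀ → ∃ ε₁ : ℝ, 0 < ε₁ ∧ ∀ (ε₀ : ℝ), 0 < ε₀ → ε₀ ≤ ε₁ →
      ∃ γ₁ : ℝ, 0 < γ₁ ∧ ∀ (F : T3Family) (γ : ℝ), F.L = L → 0 < γ → γ ≤ γ₁ →
        ∀ (J K : ℕ) (hJK : J ≤ K) (V : GaugeField (F.P J) 0 (Matrix.specialUnitaryGroup (Fin 2) ℂ)), PlaqSmall (θBal F.L γ (cw * b₀) p₀ J) V →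
          ∃ a : ℝ, Tendsto (fun lam : ℝ =>
            (Real.log (Node00.canonVersion (fieldMeasure (F.P J) 0 (Matrix.specialUnitaryGroup (Fin 2) ℂ)) (heightDensity F (γ / lam) hJK (histGood F ℰp (θBal F.L γ b₀ p₀) K J)) V) + (F.scheme ℰp (γ / lam)).β K * minActionRegPr F J K hJK ε₀ V)
            - (Real.log (Node00.canonVersion (fieldMeasure (F.P J) 0 (Matrix.specialUnitaryGroup (Fin 2) ℂ)) (heightDensity F (γ / lam) hJK (histGood F ℰp (θBal F.L γ b₀ p₀) K J)) 1) + (F.scheme ℰp (γ / lam)).β K * minActionRegPr F J K hJK ε₀ 1)) atTop (𝓝 a) := by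
  intro L
  obtain ⟨pS, H⟩ := hS L
  refine ⟨1, one_pos, le_rfl, fun cw hcw hcw1 => ⟨pS, fun b₀ p₀ hb hp hp0 => ?_⟩⟩
  obtain ⟨ε₁, hε₁, H1⟩ := H b₀ p₀ hb hp hp0
  refine ⟨ε₁, hε₁, fun ε₀ hε₀ hε₀le => ?_⟩
  obtain ⟨γ₁, hγ₁, H2⟩ := H1 ε₀ hε₀ hε₀le
  refine ⟨min γ₁ 1, lt_min hγ₁ one_pos, fun F γ hFL hγ hγle J K hJK V hV => ?_⟩
  have hθ : θBal F.L γ (cw * b₀) p₀ J ≤ θBal F.L γ b₀ p₀ J :=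
    T3InteriorExcision.θBal_mul_le (le_of_lt F.hL.2) hγ (hγle.trans (min_le_right _ _)) hb hcw1 p₀ J
  exact H2 F γ hFL hγ (hγle.trans (min_le_left _ _)) J K hJK V (T3PrintedMinimiserExistence.plaqSmall_of_le hθ hV)

open Classical in
/-- ★ **FULL WINDOW ⟹ INTERIOR WINDOW FOR REP**: `BeyondOneLoopRepCan` of LINE g19-2 (δ-unfolded, `PolymerRepOn` ∕ `IsLocal` spelled out) gives ⟨REP∘⟩ with `c₀ := 1`,
`γ₁ ↦ min γ₁ 1`: the identity and the domination clauses RESTRICT to the interior window (a subset of the full window), the polymer data are unchanged.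
[cite: Balaban1985UV3, (7) p.257; Balaban1987RG1, (0.22)-(0.26) pp.256-257] -/
theorem repInt_of_rep
    (hR : ∀ (L : ℕ), ∃ pS : ℝ, ∀ (b₀ p₀ : ℝ), 0 < b₀ → pS ≤ p₀ → 0 < p₀ → ∃ ε₁ : ℝ, 0 < ε₁ ∧ ∀ (ε₀ : ℝ), 0 < ε₀ → ε₀ ≤ ε₁ →
      ∃ γ₁ : ℝ, 0 < γ₁ ∧ ∃ κ : ℝ, 0 < κ ∧
        ∀ (F : T3Family) (γ : ℝ), F.L = L → 0 < γ → γ ≤ γ₁ →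
          ∃ Φ : ℕ → ℝ, (∀ J, 0 ≤ Φ J) ∧ Tendsto (fun J : ℕ => (J : ℝ) * Φ J) atTop (𝓝 0) ∧
            ∀ (J K : ℕ) (hJK : J ≤ K),
              ∃ (c : ℝ) (R : GaugeField (F.P J) 0 (Matrix.specialUnitaryGroup (Fin 2) ℂ) → ℝ) (a : ℝ),
                (∀ U : GaugeField (F.P J) 0 (Matrix.specialUnitaryGroup (Fin 2) ℂ), PlaqSmall (θBal F.L γ b₀ p₀ J) U →
                  (Real.log (Node00.canonVersion (fieldMeasure (F.P J) 0 (Matrix.specialUnitaryGroup (Fin 2) ℂ)) (heightDensity F (γ / 1) hJK (histGood F ℰp (θBal F.L γ b₀ p₀) K J)) U) + (F.scheme ℰp (γ / 1)).β K * minActionRegPr F J K hJK ε₀ U)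
                      = c + limUnder atTop (fun lam : ℝ => (Real.log (Node00.canonVersion (fieldMeasure (F.P J) 0 (Matrix.specialUnitaryGroup (Fin 2) ℂ)) (heightDensity F (γ / lam) hJK (histGood F ℰp (θBal F.L γ b₀ p₀) K J)) U) + (F.scheme ℰp (γ / lam)).β K * minActionRegPr F J K hJK ε₀ U)
                          - (Real.log (Node00.canonVersion (fieldMeasure (F.P J) 0 (Matrix.specialUnitaryGroup (Fin 2) ℂ)) (heightDensity F (γ / lam) hJK (histGood F ℰp (θBal F.L γ b₀ p₀) K J)) 1) + (F.scheme ℰp (γ / lam)).β K * minActionRegPr F J K hJK ε₀ 1)) + R U) ∧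
                (∃ (n : ℕ) (supp : Fin n → Finset (PBond (F.P J) 0)) (len wt : Fin n → ℝ) (act : Fin n → GaugeField (F.P J) 0 (Matrix.specialUnitaryGroup (Fin 2) ℂ) → ℝ) (c' : ℝ),
                  (∀ X (U U' : GaugeField (F.P J) 0 (Matrix.specialUnitaryGroup (Fin 2) ℂ)), (∀ e ∈ supp X, U e = U' e) → act X U = act X U') ∧
                  (∀ X, 0 ≤ wt X) ∧
                  (∀ X, ∀ e ∈ supp X, ∀ e' ∈ supp X, (e.src.tdist e'.src : ℝ) ≤ len X) ∧
                  (∀ X U, U ∈ {U : GaugeField (F.P J) 0 (Matrix.specialUnitaryGroup (Fin 2) ℂ) | PlaqSmall (θBal F.L γ b₀ p₀ J) U} → |act X U| ≤ wt X) ∧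
                  (∀ e : PBond (F.P J) 0, ∑ X ∈ Finset.univ.filter (fun X => e ∈ supp X), wt X * Real.exp (κ * len X) ≤ a) ∧
                  ∀ U, U ∈ {U : GaugeField (F.P J) 0 (Matrix.specialUnitaryGroup (Fin 2) ℂ) | PlaqSmall (θBal F.L γ b₀ p₀ J) U} →
                    R U = c' + ∑ X, act X U) ∧
                a ≤ Φ J) :
    ∀ (L : ℕ), ∃ c₀ : ℝ, 0 < c₀ ∧ c₀ ≤ 1 ∧ ∀ (cw : ℝ), 0 < cw → cw ≤ c₀ →
      ∃ pS : ℝ, ∀ (b₀ p₀ : ℝ), 0 < b₀ → pS ≤ p₀ → 0 < p₀ → ∃ ε₁ : ℝ, 0 < ε₁ ∧ ∀ (ε₀ : ℝ), 0 < ε₀ → ε₀ ≤ ε₁ →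
      ∃ γ₁ : ℝ, 0 < γ₁ ∧ ∃ κ : ℝ, 0 < κ ∧
        ∀ (F : T3Family) (γ : ℝ), F.L = L → 0 < γ → γ ≤ γ₁ →
          ∃ Φ : ℕ → ℝ, (∀ J, 0 ≤ Φ J) ∧ Tendsto (fun J : ℕ => (J : ℝ) * Φ J) atTop (𝓝 0) ∧
            ∀ (J K : ℕ) (hJK : J ≤ K),
              ∃ (c : ℝ) (R : GaugeField (F.P J) 0 (Matrix.specialUnitaryGroup (Fin 2) ℂ) → ℝ) (a : ℝ),
                (∀ U : GaugeField (F.P J) 0 (Matrix.specialUnitaryGroup (Fin 2) ℂ), PlaqSmall (θBal F.L γ (cw * b₀) p₀ J) U →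
                  (Real.log (Node00.canonVersion (fieldMeasure (F.P J) 0 (Matrix.specialUnitaryGroup (Fin 2) ℂ)) (heightDensity F (γ / 1) hJK (histGood F ℰp (θBal F.L γ b₀ p₀) K J)) U) + (F.scheme ℰp (γ / 1)).β K * minActionRegPr F J K hJK ε₀ U)
                      = c + limUnder atTop (fun lam : ℝ => (Real.log (Node00.canonVersion (fieldMeasure (F.P J) 0 (Matrix.specialUnitaryGroup (Fin 2) ℂ)) (heightDensity F (γ / lam) hJK (histGood F ℰp (θBal F.L γ b₀ p₀) K J)) U) + (F.scheme ℰp (γ / lam)).β K * minActionRegPr F J K hJK ε₀ U)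
                          - (Real.log (Node00.canonVersion (fieldMeasure (F.P J) 0 (Matrix.specialUnitaryGroup (Fin 2) ℂ)) (heightDensity F (γ / lam) hJK (histGood F ℰp (θBal F.L γ b₀ p₀) K J)) 1) + (F.scheme ℰp (γ / lam)).β K * minActionRegPr F J K hJK ε₀ 1)) + R U) ∧
                (∃ (n : ℕ) (supp : Fin n → Finset (PBond (F.P J) 0)) (len wt : Fin n → ℝ) (act : Fin n → GaugeField (F.P J) 0 (Matrix.specialUnitaryGroup (Fin 2) ℂ) → ℝ) (c' : ℝ),
                  (∀ X (U U' : GaugeField (F.P J) 0 (Matrix.specialUnitaryGroup (Fin 2) ℂ)), (∀ e ∈ supp X, U e = U' e) → act X U = act X U') ∧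
                  (∀ X, 0 ≤ wt X) ∧
                  (∀ X, ∀ e ∈ supp X, ∀ e' ∈ supp X, (e.src.tdist e'.src : ℝ) ≤ len X) ∧
                  (∀ X U, U ∈ {U : GaugeField (F.P J) 0 (Matrix.specialUnitaryGroup (Fin 2) ℂ) | PlaqSmall (θBal F.L γ (cw * b₀) p₀ J) U} → |act X U| ≤ wt X) ∧
                  (∀ e : PBond (F.P J) 0, ∑ X ∈ Finset.univ.filter (fun X => e ∈ supp X), wt X * Real.exp (κ * len X) ≤ a) ∧
                  ∀ U, U ∈ {U : GaugeField (F.P J) 0 (Matrix.specialUnitaryGroup (Fin 2) ℂ) | PlaqSmall (θBal F.L γ (cw * b₀) p₀ J) U} →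
                    R U = c' + ∑ X, act X U) ∧
                a ≤ Φ J := by
  intro L
  obtain ⟨pS, H⟩ := hR L
  refine ⟨1, one_pos, le_rfl, fun cw hcw hcw1 => ⟨pS, fun b₀ p₀ hb hp hp0 => ?_⟩⟩
  obtain ⟨ε₁, hε₁, H1⟩ := H b₀ p₀ hb hp hp0
  refine ⟨ε₁, hε₁, fun ε₀ hε₀ hε₀le => ?_⟩
  obtain ⟨γ₁, hγ₁, κ, hκ, H2⟩ := H1 ε₀ hε₀ hε₀le
  refine ⟨min γ₁ 1, lt_min hγ₁ one_pos, κ, hκ, fun F γ hFL hγ hγle => ?_⟩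
  obtain ⟨Φ, hΦ0, hΦ, H3⟩ := H2 F γ hFL hγ (hγle.trans (min_le_left _ _))
  refine ⟨Φ, hΦ0, hΦ, fun J K hJK => ?_⟩
  obtain ⟨c, R, a, hid, ⟨n, supp, len, wt, act, c', hloc, hwt, hdiam, hbd, hcov, hRid⟩, ha⟩ := H3 J K hJK
  have hθ : θBal F.L γ (cw * b₀) p₀ J ≤ θBal F.L γ b₀ p₀ J :=
    T3InteriorExcision.θBal_mul_le (le_of_lt F.hL.2) hγ (hγle.trans (min_le_right _ _)) hb hcw1 p₀ J
  have hsub : ∀ U : GaugeField (F.P J) 0 (Matrix.specialUnitaryGroup (Fin 2) ℂ),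
      PlaqSmall (θBal F.L γ (cw * b₀) p₀ J) U → PlaqSmall (θBal F.L γ b₀ p₀ J) U :=
    fun U hU => T3PrintedMinimiserExistence.plaqSmall_of_le hθ hU
  exact ⟨c, R, a, fun U hU => hid U (hsub U hU),
    ⟨n, supp, len, wt, act, c', hloc, hwt, hdiam, fun X U hU => hbd X U (hsub U hU), hcov, fun U hU => hRid U (hsub U hU)⟩, ha⟩

open Classical in
/-- ★★ **THE PLAN RE-DOCKED: ⟨SCL⟩ → ⟨REP⟩ → H4ᶜ∘ `BeyondOneLoopSmallIntCan` VERBATIM.**  LINE g19-2's OWN full-window letters — SCL `SemiclassicalLimitCan` (proved in the line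
from EXW + GAP♯ by `semiclassicalLimitCan_of_organs`) and its hand REP `BeyondOneLoopRepCan` (l.1231) — deliver the REGISTERED interior stub of registry v11.4 (l.571 ∕ l.1580), by
`sclInt_of_scl`, `repInt_of_rep` and `beyondOneLoopSmallInt_of_repInt`.  Door-fit: `example : SemiclassicalLimitCan → BeyondOneLoopRepCan → BeyondOneLoopSmallIntCan :=
fun hS hR => beyondOneLoopSmallInt_of_rep hS hR`. [cite: Balaban1985UV3, (45)-(47) p.267; Balaban1987RG1, Thm 1 (0.19)-(0.26) pp.255-257; Balaban1988Convergent, Thm 1] -/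
theorem beyondOneLoopSmallInt_of_rep
    (hS : ∀ (L : ℕ), ∃ pS : ℝ, ∀ (b₀ p₀ : ℝ), 0 < b₀ → pS ≤ p₀ → 0 < p₀ → ∃ ε₁ : ℝ, 0 < ε₁ ∧ ∀ (ε₀ : ℝ), 0 < ε₀ → ε₀ ≤ ε₁ →
      ∃ γ₁ : ℝ, 0 < γ₁ ∧ ∀ (F : T3Family) (γ : ℝ), F.L = L → 0 < γ → γ ≤ γ₁ →
        ∀ (J K : ℕ) (hJK : J ≤ K) (V : GaugeField (F.P J) 0 (Matrix.specialUnitaryGroup (Fin 2) ℂ)), PlaqSmall (θBal F.L γ b₀ p₀ J) V →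
          ∃ a : ℝ, Tendsto (fun lam : ℝ =>
            (Real.log (Node00.canonVersion (fieldMeasure (F.P J) 0 (Matrix.specialUnitaryGroup (Fin 2) ℂ)) (heightDensity F (γ / lam) hJK (histGood F ℰp (θBal F.L γ b₀ p₀) K J)) V) + (F.scheme ℰp (γ / lam)).β K * minActionRegPr F J K hJK ε₀ V)
            - (Real.log (Node00.canonVersion (fieldMeasure (F.P J) 0 (Matrix.specialUnitaryGroup (Fin 2) ℂ)) (heightDensity F (γ / lam) hJK (histGood F ℰp (θBal F.L γ b₀ p₀) K J)) 1) + (F.scheme ℰp (γ / lam)).β K * minActionRegPr F J K hJK ε₀ 1)) atTop (𝓝 a))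
    (hR : ∀ (L : ℕ), ∃ pS : ℝ, ∀ (b₀ p₀ : ℝ), 0 < b₀ → pS ≤ p₀ → 0 < p₀ → ∃ ε₁ : ℝ, 0 < ε₁ ∧ ∀ (ε₀ : ℝ), 0 < ε₀ → ε₀ ≤ ε₁ →
      ∃ γ₁ : ℝ, 0 < γ₁ ∧ ∃ κ : ℝ, 0 < κ ∧
        ∀ (F : T3Family) (γ : ℝ), F.L = L → 0 < γ → γ ≤ γ₁ →
          ∃ Φ : ℕ → ℝ, (∀ J, 0 ≤ Φ J) ∧ Tendsto (fun J : ℕ => (J : ℝ) * Φ J) atTop (𝓝 0) ∧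
            ∀ (J K : ℕ) (hJK : J ≤ K),
              ∃ (c : ℝ) (R : GaugeField (F.P J) 0 (Matrix.specialUnitaryGroup (Fin 2) ℂ) → ℝ) (a : ℝ),
                (∀ U : GaugeField (F.P J) 0 (Matrix.specialUnitaryGroup (Fin 2) ℂ), PlaqSmall (θBal F.L γ b₀ p₀ J) U →
                  (Real.log (Node00.canonVersion (fieldMeasure (F.P J) 0 (Matrix.specialUnitaryGroup (Fin 2) ℂ)) (heightDensity F (γ / 1) hJK (histGood F ℰp (θBal F.L γ b₀ p₀) K J)) U) + (F.scheme ℰp (γ / 1)).β K * minActionRegPr F J K hJK ε₀ U)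
                      = c + limUnder atTop (fun lam : ℝ => (Real.log (Node00.canonVersion (fieldMeasure (F.P J) 0 (Matrix.specialUnitaryGroup (Fin 2) ℂ)) (heightDensity F (γ / lam) hJK (histGood F ℰp (θBal F.L γ b₀ p₀) K J)) U) + (F.scheme ℰp (γ / lam)).β K * minActionRegPr F J K hJK ε₀ U)
                          - (Real.log (Node00.canonVersion (fieldMeasure (F.P J) 0 (Matrix.specialUnitaryGroup (Fin 2) ℂ)) (heightDensity F (γ / lam) hJK (histGood F ℰp (θBal F.L γ b₀ p₀) K J)) 1) + (F.scheme ℰp (γ / lam)).β K * minActionRegPr F J K hJK ε₀ 1)) + R U) ∧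
                (∃ (n : ℕ) (supp : Fin n → Finset (PBond (F.P J) 0)) (len wt : Fin n → ℝ) (act : Fin n → GaugeField (F.P J) 0 (Matrix.specialUnitaryGroup (Fin 2) ℂ) → ℝ) (c' : ℝ),
                  (∀ X (U U' : GaugeField (F.P J) 0 (Matrix.specialUnitaryGroup (Fin 2) ℂ)), (∀ e ∈ supp X, U e = U' e) → act X U = act X U') ∧
                  (∀ X, 0 ≤ wt X) ∧
                  (∀ X, ∀ e ∈ supp X, ∀ e' ∈ supp X, (e.src.tdist e'.src : ℝ) ≤ len X) ∧
                  (∀ X U, U ∈ {U : GaugeField (F.P J) 0 (Matrix.specialUnitaryGroup (Fin 2) ℂ) | PlaqSmall (θBal F.L γ b₀ p₀ J) U} → |act X U| ≤ wt X) ∧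
                  (∀ e : PBond (F.P J) 0, ∑ X ∈ Finset.univ.filter (fun X => e ∈ supp X), wt X * Real.exp (κ * len X) ≤ a) ∧
                  ∀ U, U ∈ {U : GaugeField (F.P J) 0 (Matrix.specialUnitaryGroup (Fin 2) ℂ) | PlaqSmall (θBal F.L γ b₀ p₀ J) U} →
                    R U = c' + ∑ X, act X U) ∧
                a ≤ Φ J) :
    ∀ (L : ℕ), ∃ c₀ : ℝ, 0 < c₀ ∧ c₀ ≤ 1 ∧ ∀ (c : ℝ), 0 < c → c ≤ c₀ → ∃ pS : ℝ, ∀ (b₀ p₀ : ℝ), 0 < b₀ → pS ≤ p₀ → 0 < p₀ →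
      ∃ ε₁ : ℝ, 0 < ε₁ ∧ ∀ (ε₀ : ℝ), 0 < ε₀ → ε₀ ≤ ε₁ →
      ∃ γ₁ : ℝ, 0 < γ₁ ∧ ∃ κ : ℝ, 0 < κ ∧ ∀ (F : T3Family) (γ : ℝ), F.L = L → 0 < γ → γ ≤ γ₁ →
        ∃ φ₂ : ℕ → ℝ, (∀ J, 0 ≤ φ₂ J) ∧ Tendsto (fun J : ℕ => (J : ℝ) * φ₂ J) atTop (𝓝 0) ∧
          ∀ (J K : ℕ) (hJK : J ≤ K) (b b' : PBond (F.P J) 0) (U V W Z : GaugeField (F.P J) 0 (Matrix.specialUnitaryGroup (Fin 2) ℂ)),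
            PlaqSmall (θBal F.L γ (c * b₀) p₀ J) U → PlaqSmall (θBal F.L γ (c * b₀) p₀ J) V →
            PlaqSmall (θBal F.L γ (c * b₀) p₀ J) W → PlaqSmall (θBal F.L γ (c * b₀) p₀ J) Z →
            (∀ e, e ≠ b → U e = V e) → (∀ e, e ≠ b' → U e = W e) → (∀ e, e ≠ b' → V e = Z e) → (∀ e, e ≠ b → W e = Z e) →
            |(((Real.log (Node00.canonVersion (fieldMeasure (F.P J) 0 (Matrix.specialUnitaryGroup (Fin 2) ℂ)) (heightDensity F (γ / 1) hJK (histGood F ℰp (θBal F.L γ b₀ p₀) K J)) U) + (F.scheme ℰp (γ / 1)).β K * minActionRegPr F J K hJK ε₀ U)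
                - (Real.log (Node00.canonVersion (fieldMeasure (F.P J) 0 (Matrix.specialUnitaryGroup (Fin 2) ℂ)) (heightDensity F (γ / 1) hJK (histGood F ℰp (θBal F.L γ b₀ p₀) K J)) V) + (F.scheme ℰp (γ / 1)).β K * minActionRegPr F J K hJK ε₀ V))
              - ((Real.log (Node00.canonVersion (fieldMeasure (F.P J) 0 (Matrix.specialUnitaryGroup (Fin 2) ℂ)) (heightDensity F (γ / 1) hJK (histGood F ℰp (θBal F.L γ b₀ p₀) K J)) W) + (F.scheme ℰp (γ / 1)).β K * minActionRegPr F J K hJK ε₀ W)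
                - (Real.log (Node00.canonVersion (fieldMeasure (F.P J) 0 (Matrix.specialUnitaryGroup (Fin 2) ℂ)) (heightDensity F (γ / 1) hJK (histGood F ℰp (θBal F.L γ b₀ p₀) K J)) Z) + (F.scheme ℰp (γ / 1)).β K * minActionRegPr F J K hJK ε₀ Z)))
              - limUnder atTop (fun lam : ℝ =>
                ((Real.log (Node00.canonVersion (fieldMeasure (F.P J) 0 (Matrix.specialUnitaryGroup (Fin 2) ℂ)) (heightDensity F (γ / lam) hJK (histGood F ℰp (θBal F.L γ b₀ p₀) K J)) U) + (F.scheme ℰp (γ / lam)).β K * minActionRegPr F J K hJK ε₀ U)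
                  - (Real.log (Node00.canonVersion (fieldMeasure (F.P J) 0 (Matrix.specialUnitaryGroup (Fin 2) ℂ)) (heightDensity F (γ / lam) hJK (histGood F ℰp (θBal F.L γ b₀ p₀) K J)) V) + (F.scheme ℰp (γ / lam)).β K * minActionRegPr F J K hJK ε₀ V))
                - ((Real.log (Node00.canonVersion (fieldMeasure (F.P J) 0 (Matrix.specialUnitaryGroup (Fin 2) ℂ)) (heightDensity F (γ / lam) hJK (histGood F ℰp (θBal F.L γ b₀ p₀) K J)) W) + (F.scheme ℰp (γ / lam)).β K * minActionRegPr F J K hJK ε₀ W)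
                  - (Real.log (Node00.canonVersion (fieldMeasure (F.P J) 0 (Matrix.specialUnitaryGroup (Fin 2) ℂ)) (heightDensity F (γ / lam) hJK (histGood F ℰp (θBal F.L γ b₀ p₀) K J)) Z) + (F.scheme ℰp (γ / lam)).β K * minActionRegPr F J K hJK ε₀ Z)))|
              ≤ φ₂ J * Real.exp (-(κ * (b.src.tdist b'.src : ℝ))) :=
  beyondOneLoopSmallInt_of_repInt (sclInt_of_scl hS) (repInt_of_rep hR)

end Doors

end Summit.QuantumFields.YangMills.Theorems.BeyondOneLoopInteriorDoor

end
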